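import Summits.ValiantsHypothesis.ValiantsHypothesis.Theorems.FeketeSOSFeketeSOSHardPaleyRIPRankTwoSidon

/-!
# Route FeketeSOS — crux `FeketeSOSHard` (stmt-ValiantsHypothesis-3996), line `paley-rip` (skeleton v3):
# tensor (separable) pairs on a sumset support `S = D + H` — the pattern factorises

Census `Lines/paley-rip-stub3-census.md` §4 (O6) / §6: every wild pair found by hand lives on a support `S = D + H`
(`D` additively unstructured, `H` structured) and is SEPARABLE, `a = α·U`, `b = β·V` with `α, β` supported in `D`
and `U, V` supported in `H`; such pairs are tame because their pattern factorises.  This file proves the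
factorisation and the resulting mass control; the companion `…PaleyRIPTensorTame.lean` builds the cheap
representation.  Hypotheses (all in `ℕ`, no wrap-around): `D` is Sidon; the decomposition `n = e + f`,
`e ∈ D + D`, `f ∈ H + H`, is unique (`hDirect`); and `D + D + H + H ⊂ [0,p)`.

* `coeff_ne_zero_mul` — a nonzero coefficient of `U·V` sits on `supp U + supp V`;
* `pattern_eq_mul` — the cyclic pattern `F` of `(αU)(βV)` IS the polynomial `(αβ)(UV)` (degree `< p`);
* `coeff_prod_direct` — `F_{e+f} = (αβ)_e · (UV)_f` for `e ∈ D+D`, `f ∈ H+H`;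
* `coeff_sq_sidon` — `(αβ)_{d+d'} = α_d β_{d'} + α_{d'} β_d` (`d ≠ d'`), `(αβ)_{2d} = α_d β_d`, on a Sidon `D`;
* `tensor_energy_bound` — if `|F_n| ≤ M` then `‖α‖_D ‖β‖_D · |(UV)_f| ≤ √2 · #D · M` for every `f`.

Honest framing: a structural lemma about separable pairs; `stub_tameOperator`, the engine and the crux stay OPEN;
`VP ≠ VNP` untouched.
-/

set_option linter.dupNamespace false

namespace Summit.ValiantsHypothesis.ValiantsHypothesis.Theorems.FeketeSOSHardPaleyRIP

open Polynomial Finset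
open scoped BigOperators

noncomputable section

section TensorPattern

/-- A nonzero coefficient of a product sits on the sumset of the supports. [folklore] -/
theorem coeff_ne_zero_mul {U V : ℂ[X]} {n : ℕ} (h : (U * V).coeff n ≠ 0) :
    ∃ i ∈ U.support, ∃ j ∈ V.support, i + j = n := by
  classical
  rw [coeff_mul] at h
  obtain ⟨x, hx, hne⟩ := Finset.exists_ne_zero_of_sum_ne_zero h
  refine ⟨x.1, mem_support_iff.2 (left_ne_zero_of_mul hne), x.2, mem_support_iff.2 (right_ne_zero_of_mul hne),
    mem_antidiagonal.1 hx⟩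

/-- Supports of products: `supp (U·V) ⊆ S` whenever `supp U + supp V ⊆ S` pointwise. [folklore] -/
theorem support_mul_subset_of {U V : ℂ[X]} {S : Finset ℕ}
    (hS : ∀ i ∈ U.support, ∀ j ∈ V.support, i + j ∈ S) : (U * V).support ⊆ S := by
  intro n hn
  obtain ⟨i, hi, j, hj, hij⟩ := coeff_ne_zero_mul (mem_support_iff.1 hn)
  rw [← hij]; exact hS i hi j hj

variable (p : ℕ) [Fact p.Prime]

/-- No wrap-around: the cyclic pattern of `(αU)(βV)` is the polynomial `(αβ)(UV)` itself. [folklore] -/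
theorem pattern_eq_mul (D H : Finset ℕ) (α β U V F : ℂ[X])
    (hα : α.support ⊆ D) (hβ : β.support ⊆ D) (hU : U.support ⊆ H) (hV : V.support ⊆ H)
    (hNoWrap : ∀ d ∈ D, ∀ d' ∈ D, ∀ h ∈ H, ∀ h' ∈ H, d + d' + (h + h') < p)
    (hF : F.natDegree < p) (hdvd : (X : ℂ[X]) ^ p - 1 ∣ (α * U) * (β * V) - F) :
    F = (α * β) * (U * V) := by
  classical
  have hp : 0 < p := (Fact.out : p.Prime).pos
  -- degree of the product
  have hsupp : ((α * β) * (U * V)).support ⊆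
      (((D ×ˢ D) ×ˢ (H ×ˢ H)).image fun q : (ℕ × ℕ) × (ℕ × ℕ) => q.1.1 + q.1.2 + (q.2.1 + q.2.2)) := by
    refine support_mul_subset_of fun e he f hf => ?_
    obtain ⟨d, hd, d', hd', rfl⟩ := coeff_ne_zero_mul (mem_support_iff.1 he)
    obtain ⟨h, hh, h', hh', rfl⟩ := coeff_ne_zero_mul (mem_support_iff.1 hf)
    exact Finset.mem_image.2 ⟨((d, d'), (h, h')),
      Finset.mem_product.2 ⟨Finset.mem_product.2 ⟨hα hd, hβ hd'⟩, Finset.mem_product.2 ⟨hU hh, hV hh'⟩⟩, rfl⟩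
  have hdeg : ((α * β) * (U * V)).natDegree < p := by
    by_cases h0 : (α * β) * (U * V) = 0
    · rw [h0, natDegree_zero]; exact hp
    · have hmem := hsupp (natDegree_mem_support_of_nonzero h0)
      obtain ⟨q, hq, hqe⟩ := Finset.mem_image.1 hmem
      obtain ⟨hq1, hq2⟩ := Finset.mem_product.1 hq
      obtain ⟨hd, hd'⟩ := Finset.mem_product.1 hq1
      obtain ⟨hh, hh'⟩ := Finset.mem_product.1 hq2
      rw [← hqe]; exact hNoWrap _ hd _ hd' _ hh _ hh'
  -- both `F` and the product reduce the same class and have degree `< p`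
  have hdiff : (X : ℂ[X]) ^ p - 1 ∣ (α * β) * (U * V) - F := by
    have e : (α * U) * (β * V) = (α * β) * (U * V) := by ring
    rwa [e] at hdvd
  have hlt : ((α * β) * (U * V) - F).natDegree < p :=
    lt_of_le_of_lt (natDegree_sub_le _ _) (max_lt hdeg hF)
  have := eq_zero_of_dvd_of_lt p hlt hdiff
  exact (sub_eq_zero.1 this).symm

/-- **Coefficient factorisation on a direct sumset**: if `n = e + f` decomposes uniquely with `e ∈ D + D`,
`f ∈ H + H`, then `((αβ)(UV))_{e+f} = (αβ)_e (UV)_f`. [folklore] -/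
theorem coeff_prod_direct (D H : Finset ℕ) (α β U V : ℂ[X])
    (hα : α.support ⊆ D) (hβ : β.support ⊆ D) (hU : U.support ⊆ H) (hV : V.support ⊆ H)
    (hDirect : ∀ d₁ ∈ D, ∀ d₂ ∈ D, ∀ d₁' ∈ D, ∀ d₂' ∈ D, ∀ h₁ ∈ H, ∀ h₂ ∈ H, ∀ h₁' ∈ H, ∀ h₂' ∈ H,
      d₁ + d₂ + (h₁ + h₂) = d₁' + d₂' + (h₁' + h₂') → d₁ + d₂ = d₁' + d₂')
    {d d' h h' : ℕ} (hd : d ∈ D) (hd' : d' ∈ D) (hh : h ∈ H) (hh' : h' ∈ H) :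
    ((α * β) * (U * V)).coeff (d + d' + (h + h')) = (α * β).coeff (d + d') * (U * V).coeff (h + h') := by
  classical
  rw [coeff_mul, Finset.sum_eq_single (d + d', h + h')]
  · rintro ⟨e, f⟩ hef hne
    -- a nonzero term forces `e ∈ D+D`, `f ∈ H+H`, hence `(e,f) = (d+d', h+h')`
    by_contra hprod
    have he : (α * β).coeff e ≠ 0 := left_ne_zero_of_mul hprod
    have hf : (U * V).coeff f ≠ 0 := right_ne_zero_of_mul hprod
    obtain ⟨d₁, hd₁, d₂, hd₂, rfl⟩ := coeff_ne_zero_mul he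
    obtain ⟨h₁, hh₁, h₂, hh₂, rfl⟩ := coeff_ne_zero_mul hf
    have hsum : d₁ + d₂ + (h₁ + h₂) = d + d' + (h + h') := mem_antidiagonal.1 hef
    have h1 : d₁ + d₂ = d + d' :=
      hDirect d₁ (hα hd₁) d₂ (hβ hd₂) d hd d' hd' h₁ (hU hh₁) h₂ (hV hh₂) h hh h' hh' hsum
    have h2 : h₁ + h₂ = h + h' := by omega
    exact hne (Prod.ext h1 h2)
  · intro h0
    exact absurd (mem_antidiagonal.2 (rfl : (d + d', h + h').1 + (d + d', h + h').2 = d + d' + (h + h'))) h0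

/-- **Coefficients of `αβ` on a Sidon set**: the antidiagonal of `d + d'` meets `D × D` only in `(d,d')` and
`(d',d)`. [folklore] -/
theorem coeff_sq_sidon (D : Finset ℕ) (α β : ℂ[X]) (hα : α.support ⊆ D) (hβ : β.support ⊆ D)
    (hSidon : ∀ d₁ ∈ D, ∀ d₂ ∈ D, ∀ d₁' ∈ D, ∀ d₂' ∈ D,
      d₁ + d₂ = d₁' + d₂' → (d₁ = d₁' ∧ d₂ = d₂') ∨ (d₁ = d₂' ∧ d₂ = d₁'))
    {d d' : ℕ} (hd : d ∈ D) (hd' : d' ∈ D) :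
    (α * β).coeff (d + d') =
      if d = d' then α.coeff d * β.coeff d' else α.coeff d * β.coeff d' + α.coeff d' * β.coeff d := by
  classical
  have hvan : ∀ q ∈ antidiagonal (d + d'), q ≠ (d, d') → q ≠ (d', d) → α.coeff q.1 * β.coeff q.2 = 0 := by
    rintro ⟨i, j⟩ hq h1 h2
    by_contra hne
    have hi : i ∈ D := hα (mem_support_iff.2 (left_ne_zero_of_mul hne))
    have hj : j ∈ D := hβ (mem_support_iff.2 (right_ne_zero_of_mul hne))
    rcases hSidon i hi j hj d hd d' hd' (mem_antidiagonal.1 hq) with ⟨r1, r2⟩ | ⟨r1, r2⟩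
    · exact h1 (Prod.ext r1 r2)
    · exact h2 (Prod.ext r1 r2)
  rw [coeff_mul]
  split_ifs with hdd
  · subst hdd
    rw [Finset.sum_eq_single (d, d)]
    · intro q hq hne; exact hvan q hq hne hne
    · intro h0; exact absurd (mem_antidiagonal.2 (rfl : (d, d).1 + (d, d).2 = d + d)) h0
  · have hne : ((d, d') : ℕ × ℕ) ≠ (d', d) := fun h => hdd (Prod.mk.inj h).1
    rw [Finset.sum_eq_add_of_mem (d, d') (d', d) (mem_antidiagonal.2 rfl) (mem_antidiagonal.2 (add_comm _ _)) hne]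
    intro q hq hq2
    exact hvan q hq hq2.1 hq2.2

/-- **Mass control for separable pairs.**  Under the tensor hypotheses, if the pattern `F = (αβ)(UV)` has
coefficients of modulus `≤ M`, then `(Σ_{d∈D}|α_d|²)(Σ_{d∈D}|β_d|²) · |(UV)_f|² ≤ 2 · #D² · M²` for every `f = h + h'`,
`h, h' ∈ H` (energy identity on `D` + the factorisation). [folklore] -/
theorem tensor_energy_bound (D H : Finset ℕ) (α β U V F : ℂ[X])
    (hα : α.support ⊆ D) (hβ : β.support ⊆ D) (hU : U.support ⊆ H) (hV : V.support ⊆ H)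
    (hSidon : ∀ d₁ ∈ D, ∀ d₂ ∈ D, ∀ d₁' ∈ D, ∀ d₂' ∈ D,
      d₁ + d₂ = d₁' + d₂' → (d₁ = d₁' ∧ d₂ = d₂') ∨ (d₁ = d₂' ∧ d₂ = d₁'))
    (hDirect : ∀ d₁ ∈ D, ∀ d₂ ∈ D, ∀ d₁' ∈ D, ∀ d₂' ∈ D, ∀ h₁ ∈ H, ∀ h₂ ∈ H, ∀ h₁' ∈ H, ∀ h₂' ∈ H,
      d₁ + d₂ + (h₁ + h₂) = d₁' + d₂' + (h₁' + h₂') → d₁ + d₂ = d₁' + d₂')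
    (hFeq : F = (α * β) * (U * V)) (M : ℝ) (hM : ∀ n, ‖F.coeff n‖ ≤ M)
    {h h' : ℕ} (hh : h ∈ H) (hh' : h' ∈ H) :
    (∑ d ∈ D, ‖α.coeff d‖ ^ 2) * (∑ d ∈ D, ‖β.coeff d‖ ^ 2) * ‖(U * V).coeff (h + h')‖ ^ 2 ≤
      2 * (D.card : ℝ) ^ 2 * M ^ 2 := by
  classical
  have hM0 : 0 ≤ M := (norm_nonneg _).trans (hM 0)
  set g : ℂ := (U * V).coeff (h + h') with hg
  -- `|α_d β_d' + α_d' β_d| · |g| ≤ 2M` for all `d, d' ∈ D`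
  have hP : ∀ d ∈ D, ∀ d' ∈ D, ‖(α.coeff d * β.coeff d' + α.coeff d' * β.coeff d) * g‖ ≤ 2 * M := by
    intro d hd d' hd'
    have hcoef := coeff_prod_direct D H α β U V hα hβ hU hV hDirect hd hd' hh hh'
    rw [← hFeq, coeff_sq_sidon D α β hα hβ hSidon hd hd'] at hcoef
    by_cases hdd : d = d'
    · subst hdd
      rw [if_pos rfl] at hcoef
      have e : (α.coeff d * β.coeff d + α.coeff d * β.coeff d) * g = 2 * F.coeff (d + d + (h + h')) := by
        rw [hcoef, hg]; ring
      rw [e, norm_mul, Complex.norm_two]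
      linarith [hM (d + d + (h + h'))]
    · rw [if_neg hdd] at hcoef
      rw [← hg] at hcoef
      rw [← hcoef]
      linarith [hM (d + d' + (h + h'))]
  -- energy identity with `a = α·g`-weights: apply it to `a_d = α_d`, `b_d = β_d·g`
  have hE := energy_identity_le D (fun d => α.coeff d) (fun d => β.coeff d * g)
  have hsum : ∑ d ∈ D, ∑ d' ∈ D, ‖α.coeff d * (β.coeff d' * g) + α.coeff d' * (β.coeff d * g)‖ ^ 2 ≤
      ∑ d ∈ D, ∑ d' ∈ D, (2 * M) ^ 2 := by
    refine Finset.sum_le_sum fun d hd => Finset.sum_le_sum fun d' hd' => ?_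
    have e : α.coeff d * (β.coeff d' * g) + α.coeff d' * (β.coeff d * g) =
        (α.coeff d * β.coeff d' + α.coeff d' * β.coeff d) * g := by ring
    rw [e]
    exact pow_le_pow_left₀ (norm_nonneg _) (hP d hd d' hd') 2
  rw [Finset.sum_const, Finset.sum_const, smul_smul, nsmul_eq_mul, Nat.cast_mul] at hsum
  have hβg : ∑ d ∈ D, ‖β.coeff d * g‖ ^ 2 = (∑ d ∈ D, ‖β.coeff d‖ ^ 2) * ‖g‖ ^ 2 := by
    rw [Finset.sum_mul]
    exact Finset.sum_congr rfl fun d _ => by rw [norm_mul, mul_pow]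
  rw [hβg] at hE
  nlinarith [hE, hsum]

end TensorPattern

end

end Summit.ValiantsHypothesis.ValiantsHypothesis.Theorems.FeketeSOSHardPaleyRIP
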